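import Mathlib
import HarnessLib.Audit
import Summits.PneNP.PneNP.Theorems.PstarMultiUnion

/-!
# The multi-variable union split: `MultiUnionFive → TerminalFiveOutside` (ROUND-25, memo §14.29 (Rb) / §14.30; the reduction left to provers in `PstarMultiUnion`)

FRONTIER range-avoidance ladder, rung F-N3, ROUND 25 (cell `pnp-ideate`, planner memo `r24/CORE-BOUND-NOTES.md` §14.29–§14.30, planner p3 g23's
`r25/SketchMultiUnion.lean` (the sorried `terminalFiveOutside_of_multiUnionFive`); restricted-model proof complexity — nothing here bears on `P` versus `NP`).

FIBRING A TERMINAL CORE OVER ITS OUTSIDE PARTNERS.  For a G-constraint `w = (C, G, t)` and a set `Zs` of variables, fixing `x_z := ξ_z` (`z ∈ Zs`) turns `w` into the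
FIBRE CONSTRAINT `fib w Zs ξ = (fibL ξ, fibG, t + κ(ξ))`: the monomials with no slot in `Zs` survive (`fibG`); a monomial with exactly one slot in `Zs` becomes the
linear read of its other variable with coefficient `ξ` of the slot in `Zs` (collected with multiplicity in `lcoef`, `fibL ξ = {v ∉ Zs : lcoef ξ v = 1}`); linear reads
in `Zs` and monomials inside `Zs` become the constant `κ(ξ)` (`fibK`).  The index is a full assignment `ξ : Fin n → Bool` of which only the `Zs`-coordinates matter
(`k := n` in `PstarMultiUnion.MultiUnionTerminal`).

* `bit_gval_fib` — **the evaluation identity** `w(x) = (fib w Zs ξ)(x) + κ(ξ)` whenever `x` agrees with `ξ` on `Zs`;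
* `fibL_fadd` — the linear parts form an AFFINE family; `exists_gate_of_mem_symmDiff` — they move only in AND-slot variables;
* `multiUnionTerminal_fib` — a terminal core with `Zs` outside `J₀` fibres into multi-union-terminal data (`A := fib w₁ Zs`, `W := fib w₂ Zs`, `k := n`);
* `lin_eq_zero`, `fibK_eq_zero`, `fib_const` — a constraint touching no variable of `Zs` has constant fibres (the `W`-constant case).

The reduction itself (`Zs := zset`, the outside partners of the privates-touching monomials; `MultiUnionFive → TerminalFiveOutside`, and the `W`-constant instance
class as a theorem) is `PstarMultiUnionOutside`.
-/

set_option linter.dupNamespace false -- `Summit.PneNP.PneNP.…`: summit = sub-problem name (D-0017 single-conjunct layout)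

open Finset Literature.Computability.Complexity
open scoped symmDiff
open Summit.PneNP.PneNP.Theorems.PstarFibrePolys (bit bit_injective bit_xor)
open Summit.PneNP.PneNP.Theorems.PstarTyped (Typed)
open Summit.PneNP.PneNP.Theorems.PstarSALevel (varSet bdry BoundaryExpanding SimpleOverlap)
open Summit.PneNP.PneNP.Theorems.PstarGapPeeling (eval_congr)
open Summit.PneNP.PneNP.Theorems.PstarCentreFree (vars_mem_varSet)
open Summit.PneNP.PneNP.Theorems.PstarGapOneAll (gval)
open Summit.PneNP.PneNP.Theorems.PstarGConstraint (bit_gval)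
open Summit.PneNP.PneNP.Theorems.PstarCoreBound (XorClosed)
open Summit.PneNP.PneNP.Theorems.PstarChordRepair (IsChord)
open Summit.PneNP.PneNP.Theorems.PstarChordBridgeCotree (Peelable)
open Summit.PneNP.PneNP.Theorems.PstarChordBridgeTools (privs mem_privs)
open Summit.PneNP.PneNP.Theorems.PstarCoreBoundTargets (Terminal)
open Summit.PneNP.PneNP.Theorems.PstarUnion (SatPair)
open Summit.PneNP.PneNP.Theorems.PstarMultiUnion (Outside OutsidePartners TerminalFiveOutside fadd fzero AffineFamily MultiUnionTerminal
  MultiUnionFive MultiUnionFiveFixed)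

namespace Summit.PneNP.PneNP.Theorems.PstarMultiUnionSplit

variable {n m : ℕ}

/-! ## The fibre constraint -/

/-- the `ξ`-dependent part of the linear coefficient of `v`: the monomials `(v, z)` / `(z, v)` with `z ∈ Zs`, weighted `ξ_z` (with multiplicity) -/
def lin (I : LocalMap 4 n m) (w : Finset (Fin n) × Finset (Fin m) × Bool) (Zs : Finset (Fin n)) (ξ : Fin n → Bool) (v : Fin n) : ZMod 2 :=
  ∑ g ∈ w.2.1 with (I.vars g 2 = v ∧ I.vars g 3 ∈ Zs), bit (ξ (I.vars g 3)) +
    ∑ g ∈ w.2.1 with (I.vars g 3 = v ∧ I.vars g 2 ∈ Zs), bit (ξ (I.vars g 2))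

/-- the linear coefficient of `v` in the fibre at `ξ` -/
def lcoef (I : LocalMap 4 n m) (w : Finset (Fin n) × Finset (Fin m) × Bool) (Zs : Finset (Fin n)) (ξ : Fin n → Bool) (v : Fin n) : ZMod 2 :=
  (if v ∈ w.1 then 1 else 0) + lin I w Zs ξ v

/-- the linear part of the fibre at `ξ`: variables off `Zs` with odd coefficient -/
def fibL (I : LocalMap 4 n m) (w : Finset (Fin n) × Finset (Fin m) × Bool) (Zs : Finset (Fin n)) (ξ : Fin n → Bool) : Finset (Fin n) :=
  univ.filter fun v => v ∉ Zs ∧ lcoef I w Zs ξ v = 1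

/-- the monomials of the fibre: those with no slot in `Zs` -/
def fibG (I : LocalMap 4 n m) (w : Finset (Fin n) × Finset (Fin m) × Bool) (Zs : Finset (Fin n)) : Finset (Fin m) :=
  w.2.1.filter fun g => I.vars g 2 ∉ Zs ∧ I.vars g 3 ∉ Zs

/-- the constant of the fibre at `ξ`: linear reads in `Zs` and monomials inside `Zs` -/
def fibK (I : LocalMap 4 n m) (w : Finset (Fin n) × Finset (Fin m) × Bool) (Zs : Finset (Fin n)) (ξ : Fin n → Bool) : ZMod 2 :=
  ∑ v ∈ w.1 with v ∈ Zs, bit (ξ v) + ∑ g ∈ w.2.1 with (I.vars g 2 ∈ Zs ∧ I.vars g 3 ∈ Zs), bit (ξ (I.vars g 2)) * bit (ξ (I.vars g 3))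

/-- a Boolean with prescribed `bit` -/
def tbit (a : ZMod 2) : Bool := decide (a = 1)

/-- `bit (tbit a) = a`. -/
theorem bit_tbit (a : ZMod 2) : bit (tbit a) = a := by
  unfold tbit; revert a; decide

/-- **The fibre constraint** of `w` at `ξ` over `Zs`. -/
def fib (I : LocalMap 4 n m) (w : Finset (Fin n) × Finset (Fin m) × Bool) (Zs : Finset (Fin n)) (ξ : Fin n → Bool) :
    Finset (Fin n) × Finset (Fin m) × Bool :=
  (fibL I w Zs ξ, fibG I w Zs, tbit (bit w.2.2 + fibK I w Zs ξ))

section Fibre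

variable (I : LocalMap 4 n m) (w : Finset (Fin n) × Finset (Fin m) × Bool) (Zs : Finset (Fin n))

/-- The fibre's linear part avoids `Zs`. -/
theorem not_mem_of_mem_fibL {ξ : Fin n → Bool} {v : Fin n} (h : v ∈ fibL I w Zs ξ) : v ∉ Zs := by
  unfold fibL at h
  exact (mem_filter.1 h).2.1

/-- Membership in the fibre's linear part. -/
theorem mem_fibL {ξ : Fin n → Bool} {v : Fin n} : v ∈ fibL I w Zs ξ ↔ v ∉ Zs ∧ lcoef I w Zs ξ v = 1 := by
  unfold fibL
  rw [mem_filter]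
  exact ⟨fun h => h.2, fun h => ⟨mem_univ _, h⟩⟩

/-- The fibre's monomials are monomials of `w` with no slot in `Zs`. -/
theorem mem_fibG {g : Fin m} : g ∈ fibG I w Zs ↔ g ∈ w.2.1 ∧ I.vars g 2 ∉ Zs ∧ I.vars g 3 ∉ Zs := by
  unfold fibG
  rw [mem_filter]

/-- `fibG ⊆ G`. -/
theorem fibG_subset : fibG I w Zs ⊆ w.2.1 := by
  unfold fibG; exact filter_subset _ _

/-- `lin` at the zero index vanishes. -/
theorem lin_fzero (v : Fin n) : lin I w Zs (fzero n) v = 0 := by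
  unfold lin fzero
  simp [bit]

/-- `lin` is additive in the index. -/
theorem lin_fadd (ξ η : Fin n → Bool) (v : Fin n) : lin I w Zs (fadd ξ η) v = lin I w Zs ξ v + lin I w Zs η v := by
  unfold lin fadd
  simp only [bit_xor, sum_add_distrib]
  ring

/-- **The linear parts form an affine family**: `fibL (ξ + η) = fibL ξ ∆ fibL η ∆ fibL 0`. -/
theorem fibL_fadd (ξ η : Fin n → Bool) :
    fibL I w Zs (fadd ξ η) = (fibL I w Zs ξ ∆ fibL I w Zs η) ∆ fibL I w Zs (fzero n) := by
  ext v
  rw [mem_symmDiff, mem_symmDiff, mem_fibL, mem_fibL, mem_fibL, mem_fibL]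
  unfold lcoef
  rw [lin_fadd, lin_fzero]
  by_cases hv : v ∈ Zs
  · simp [hv]
  · simp only [hv, not_false_eq_true, true_and]
    generalize lin I w Zs ξ v = a
    generalize lin I w Zs η v = b
    by_cases hC : v ∈ w.1
    · simp only [hC, if_true]
      revert a b; decide
    · simp only [hC, if_false]
      revert a b; decide

/-- **The linear parts move only at gated variables**: a variable in `fibL 0 ∆ fibL ξ` is an AND slot of a monomial of `w` whose other slot is in `Zs`. -/
theorem exists_gate_of_mem_symmDiff {ξ : Fin n → Bool} {v : Fin n} (h : v ∈ fibL I w Zs (fzero n) ∆ fibL I w Zs ξ) :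
    ∃ g ∈ w.2.1, (I.vars g 2 = v ∧ I.vars g 3 ∈ Zs) ∨ (I.vars g 3 = v ∧ I.vars g 2 ∈ Zs) := by
  classical
  have hne : lin I w Zs ξ v ≠ 0 := by
    intro h0
    rw [mem_symmDiff, mem_fibL, mem_fibL] at h
    unfold lcoef at h
    rw [lin_fzero, h0] at h
    tauto
  unfold lin at hne
  by_contra hno
  push Not at hno
  apply hne
  have h1 : ∑ g ∈ w.2.1 with (I.vars g 2 = v ∧ I.vars g 3 ∈ Zs), bit (ξ (I.vars g 3)) = 0 :=
    sum_eq_zero fun g hg => absurd (mem_filter.1 hg).2.2 ((hno g (mem_filter.1 hg).1).1 (mem_filter.1 hg).2.1)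
  have h2 : ∑ g ∈ w.2.1 with (I.vars g 3 = v ∧ I.vars g 2 ∈ Zs), bit (ξ (I.vars g 2)) = 0 :=
    sum_eq_zero fun g hg => absurd (mem_filter.1 hg).2.2 ((hno g (mem_filter.1 hg).1).2 (mem_filter.1 hg).2.1)
  rw [h1, h2, add_zero]

/-- **THE EVALUATION IDENTITY.**  If `x` agrees with `ξ` on `Zs` then `w(x) = (fib w Zs ξ)(x) + κ(ξ)` (as bits). -/
theorem bit_gval_fib (ξ x : Fin n → Bool) (hx : ∀ z ∈ Zs, x z = ξ z) :
    bit (gval I w.1 w.2.1 x) = bit (gval I (fibL I w Zs ξ) (fibG I w Zs) x) + fibK I w Zs ξ := by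
  classical
  rw [bit_gval, bit_gval]
  -- the linear part of `w`
  have hC : ∑ v ∈ w.1, bit (x v) = ∑ v ∈ w.1 with v ∉ Zs, bit (x v) + ∑ v ∈ w.1 with v ∈ Zs, bit (ξ v) := by
    rw [← sum_filter_add_sum_filter_not w.1 (fun v => v ∈ Zs), add_comm]
    congr 1
    exact sum_congr rfl fun v hv => by rw [hx v (mem_filter.1 hv).2]
  -- the monomials of `w`, four ways
  have hG : ∑ g ∈ w.2.1, bit (x (I.vars g 2)) * bit (x (I.vars g 3)) =
      ∑ g ∈ fibG I w Zs, bit (x (I.vars g 2)) * bit (x (I.vars g 3)) +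
      ∑ g ∈ w.2.1 with (I.vars g 2 ∉ Zs ∧ I.vars g 3 ∈ Zs), bit (x (I.vars g 2)) * bit (ξ (I.vars g 3)) +
      ∑ g ∈ w.2.1 with (I.vars g 2 ∈ Zs ∧ I.vars g 3 ∉ Zs), bit (ξ (I.vars g 2)) * bit (x (I.vars g 3)) +
      ∑ g ∈ w.2.1 with (I.vars g 2 ∈ Zs ∧ I.vars g 3 ∈ Zs), bit (ξ (I.vars g 2)) * bit (ξ (I.vars g 3)) := by
    unfold fibG
    rw [← sum_filter_add_sum_filter_not w.2.1 (fun g => I.vars g 2 ∈ Zs)]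
    rw [← sum_filter_add_sum_filter_not (w.2.1.filter fun g => I.vars g 2 ∈ Zs) (fun g => I.vars g 3 ∈ Zs)]
    rw [← sum_filter_add_sum_filter_not (w.2.1.filter fun g => ¬ I.vars g 2 ∈ Zs) (fun g => I.vars g 3 ∈ Zs)]
    simp only [filter_filter]
    have e1 : ∑ g ∈ w.2.1 with (I.vars g 2 ∈ Zs ∧ I.vars g 3 ∈ Zs), bit (x (I.vars g 2)) * bit (x (I.vars g 3)) =
        ∑ g ∈ w.2.1 with (I.vars g 2 ∈ Zs ∧ I.vars g 3 ∈ Zs), bit (ξ (I.vars g 2)) * bit (ξ (I.vars g 3)) :=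
      sum_congr rfl fun g hg => by rw [hx _ (mem_filter.1 hg).2.1, hx _ (mem_filter.1 hg).2.2]
    have e2 : ∑ g ∈ w.2.1 with (I.vars g 2 ∈ Zs ∧ ¬ I.vars g 3 ∈ Zs), bit (x (I.vars g 2)) * bit (x (I.vars g 3)) =
        ∑ g ∈ w.2.1 with (I.vars g 2 ∈ Zs ∧ I.vars g 3 ∉ Zs), bit (ξ (I.vars g 2)) * bit (x (I.vars g 3)) :=
      sum_congr rfl fun g hg => by rw [hx _ (mem_filter.1 hg).2.1]
    have e3 : ∑ g ∈ w.2.1 with (¬ I.vars g 2 ∈ Zs ∧ I.vars g 3 ∈ Zs), bit (x (I.vars g 2)) * bit (x (I.vars g 3)) =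
        ∑ g ∈ w.2.1 with (I.vars g 2 ∉ Zs ∧ I.vars g 3 ∈ Zs), bit (x (I.vars g 2)) * bit (ξ (I.vars g 3)) :=
      sum_congr rfl fun g hg => by rw [hx _ (mem_filter.1 hg).2.2]
    rw [e1, e2, e3]
    ring
  -- the linear part of the fibre, as a weighted sum over the variables off `Zs`
  have h01 : ∀ a : ZMod 2, a = 0 ∨ a = 1 := by decide
  have step1 : ∑ v ∈ fibL I w Zs ξ, bit (x v) = ∑ v ∈ univ.filter (fun v : Fin n => v ∉ Zs), lcoef I w Zs ξ v * bit (x v) := by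
    unfold fibL
    rw [← filter_filter, sum_filter]
    refine sum_congr rfl fun v _ => ?_
    rcases h01 (lcoef I w Zs ξ v) with h | h
    · rw [h, if_neg zero_ne_one, zero_mul]
    · rw [h, if_pos rfl, one_mul]
  have step2 : ∑ v ∈ univ.filter (fun v : Fin n => v ∉ Zs), lcoef I w Zs ξ v * bit (x v) =
      ∑ v ∈ univ.filter (fun v : Fin n => v ∉ Zs), (if v ∈ w.1 then (1 : ZMod 2) else 0) * bit (x v) +
      ∑ v ∈ univ.filter (fun v : Fin n => v ∉ Zs), (∑ g ∈ w.2.1 with (I.vars g 2 = v ∧ I.vars g 3 ∈ Zs), bit (ξ (I.vars g 3))) * bit (x v) +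
      ∑ v ∈ univ.filter (fun v : Fin n => v ∉ Zs), (∑ g ∈ w.2.1 with (I.vars g 3 = v ∧ I.vars g 2 ∈ Zs), bit (ξ (I.vars g 2))) * bit (x v) := by
    rw [← sum_add_distrib, ← sum_add_distrib]
    refine sum_congr rfl fun v _ => ?_
    unfold lcoef lin
    ring
  have hL1 : ∑ v ∈ univ.filter (fun v : Fin n => v ∉ Zs), (if v ∈ w.1 then (1 : ZMod 2) else 0) * bit (x v) = ∑ v ∈ w.1 with v ∉ Zs, bit (x v) := by
    have e : ∀ v, (if v ∈ w.1 then (1 : ZMod 2) else 0) * bit (x v) = if v ∈ w.1 then bit (x v) else 0 := fun v => by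
      split_ifs
      · rw [one_mul]
      · rw [zero_mul]
    simp_rw [e]
    rw [← sum_filter]
    have hset : (univ.filter fun v : Fin n => v ∉ Zs).filter (fun v => v ∈ w.1) = w.1.filter fun v => v ∉ Zs := by
      ext v
      simp only [mem_filter, mem_univ, true_and]
      exact and_comm
    rw [hset]
  have hL2 : ∑ v ∈ univ.filter (fun v : Fin n => v ∉ Zs), (∑ g ∈ w.2.1 with (I.vars g 2 = v ∧ I.vars g 3 ∈ Zs), bit (ξ (I.vars g 3))) * bit (x v) =
      ∑ g ∈ w.2.1 with (I.vars g 2 ∉ Zs ∧ I.vars g 3 ∈ Zs), bit (x (I.vars g 2)) * bit (ξ (I.vars g 3)) := by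
    rw [← sum_fiberwise_of_maps_to (s := w.2.1.filter fun g => I.vars g 2 ∉ Zs ∧ I.vars g 3 ∈ Zs)
      (t := univ.filter fun v : Fin n => v ∉ Zs) (g := fun g => I.vars g 2)
      (fun g hg => mem_filter.2 ⟨mem_univ _, (mem_filter.1 hg).2.1⟩) (fun g => bit (x (I.vars g 2)) * bit (ξ (I.vars g 3)))]
    refine sum_congr rfl fun v hv => ?_
    have hvZ : v ∉ Zs := (mem_filter.1 hv).2
    rw [sum_mul, filter_filter]
    have hset : (w.2.1.filter fun g => (I.vars g 2 ∉ Zs ∧ I.vars g 3 ∈ Zs) ∧ I.vars g 2 = v) =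
        w.2.1.filter fun g => I.vars g 2 = v ∧ I.vars g 3 ∈ Zs :=
      filter_congr fun g _ => ⟨fun h => ⟨h.2, h.1.2⟩, fun h => ⟨⟨by rw [h.1]; exact hvZ, h.2⟩, h.1⟩⟩
    rw [hset]
    refine sum_congr rfl fun g hg => ?_
    rw [(mem_filter.1 hg).2.1, mul_comm]
  have hL3 : ∑ v ∈ univ.filter (fun v : Fin n => v ∉ Zs), (∑ g ∈ w.2.1 with (I.vars g 3 = v ∧ I.vars g 2 ∈ Zs), bit (ξ (I.vars g 2))) * bit (x v) =
      ∑ g ∈ w.2.1 with (I.vars g 2 ∈ Zs ∧ I.vars g 3 ∉ Zs), bit (ξ (I.vars g 2)) * bit (x (I.vars g 3)) := by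
    rw [← sum_fiberwise_of_maps_to (s := w.2.1.filter fun g => I.vars g 2 ∈ Zs ∧ I.vars g 3 ∉ Zs)
      (t := univ.filter fun v : Fin n => v ∉ Zs) (g := fun g => I.vars g 3)
      (fun g hg => mem_filter.2 ⟨mem_univ _, (mem_filter.1 hg).2.2⟩) (fun g => bit (ξ (I.vars g 2)) * bit (x (I.vars g 3)))]
    refine sum_congr rfl fun v hv => ?_
    have hvZ : v ∉ Zs := (mem_filter.1 hv).2
    rw [sum_mul, filter_filter]
    have hset : (w.2.1.filter fun g => (I.vars g 2 ∈ Zs ∧ I.vars g 3 ∉ Zs) ∧ I.vars g 3 = v) =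
        w.2.1.filter fun g => I.vars g 3 = v ∧ I.vars g 2 ∈ Zs :=
      filter_congr fun g _ => ⟨fun h => ⟨h.2, h.1.1⟩, fun h => ⟨⟨h.2, by rw [h.1]; exact hvZ⟩, h.1⟩⟩
    rw [hset]
    refine sum_congr rfl fun g hg => ?_
    rw [(mem_filter.1 hg).2.1]
  have hL : ∑ v ∈ fibL I w Zs ξ, bit (x v) = ∑ v ∈ w.1 with v ∉ Zs, bit (x v) +
      ∑ g ∈ w.2.1 with (I.vars g 2 ∉ Zs ∧ I.vars g 3 ∈ Zs), bit (x (I.vars g 2)) * bit (ξ (I.vars g 3)) +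
      ∑ g ∈ w.2.1 with (I.vars g 2 ∈ Zs ∧ I.vars g 3 ∉ Zs), bit (ξ (I.vars g 2)) * bit (x (I.vars g 3)) := by
    rw [step1, step2, hL1, hL2, hL3]
  rw [hC, hG, hL]
  unfold fibK
  ring

/-- **Solvability on a fibre.**  If `x` agrees with `ξ` on `Zs`: `w` holds at `x` iff the fibre constraint `fib w Zs ξ` holds at `x`. -/
theorem gval_fib_iff (ξ x : Fin n → Bool) (hx : ∀ z ∈ Zs, x z = ξ z) :
    gval I w.1 w.2.1 x = w.2.2 ↔ gval I (fib I w Zs ξ).1 (fib I w Zs ξ).2.1 x = (fib I w Zs ξ).2.2 := by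
  have h := bit_gval_fib I w Zs ξ x hx
  show _ ↔ gval I (fibL I w Zs ξ) (fibG I w Zs) x = tbit (bit w.2.2 + fibK I w Zs ξ)
  rw [← bit_injective.eq_iff, ← bit_injective.eq_iff, bit_tbit, h]
  constructor
  · intro e; rw [← e]; generalize bit (gval I (fibL I w Zs ξ) (fibG I w Zs) x) = a; generalize fibK I w Zs ξ = c; revert a c; decide
  · intro e; rw [e]; generalize fibK I w Zs ξ = c; generalize bit w.2.2 = a; revert a c; decide

/-- The fibre constraint does not read `Zs`. -/
theorem gval_fib_congr (ξ : Fin n → Bool) {x x' : Fin n → Bool} (h : ∀ v, v ∉ Zs → x v = x' v) :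
    gval I (fib I w Zs ξ).1 (fib I w Zs ξ).2.1 x = gval I (fib I w Zs ξ).1 (fib I w Zs ξ).2.1 x' := by
  apply bit_injective
  show bit (gval I (fibL I w Zs ξ) (fibG I w Zs) x) = bit (gval I (fibL I w Zs ξ) (fibG I w Zs) x')
  rw [bit_gval, bit_gval]
  congr 1
  · exact sum_congr rfl fun v hv => by rw [h v (not_mem_of_mem_fibL I w Zs hv)]
  · exact sum_congr rfl fun g hg => by rw [h _ ((mem_fibG I w Zs).1 hg).2.1, h _ ((mem_fibG I w Zs).1 hg).2.2]

/-- The fibres form an affine family. -/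
theorem affineFamily_fib : AffineFamily (k := n) (fib I w Zs) :=
  ⟨fun _ => rfl, fun ξ η => fibL_fadd I w Zs ξ η⟩

/-- A constraint none of whose monomials has a slot in `Zs` has `lin = 0`. -/
theorem lin_eq_zero (h : ∀ z ∈ Zs, ∀ g ∈ w.2.1, I.vars g 2 ≠ z ∧ I.vars g 3 ≠ z) (ξ : Fin n → Bool) (v : Fin n) :
    lin I w Zs ξ v = 0 := by
  have h1 : ∑ g ∈ w.2.1 with (I.vars g 2 = v ∧ I.vars g 3 ∈ Zs), bit (ξ (I.vars g 3)) = 0 :=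
    sum_eq_zero fun g hg => absurd (mem_filter.1 hg).2.2 fun hz => (h _ hz g (mem_filter.1 hg).1).2 rfl
  have h2 : ∑ g ∈ w.2.1 with (I.vars g 3 = v ∧ I.vars g 2 ∈ Zs), bit (ξ (I.vars g 2)) = 0 :=
    sum_eq_zero fun g hg => absurd (mem_filter.1 hg).2.2 fun hz => (h _ hz g (mem_filter.1 hg).1).1 rfl
  unfold lin
  rw [h1, h2, add_zero]

/-- A constraint touching no variable of `Zs` has `κ = 0`. -/
theorem fibK_eq_zero (h : ∀ z ∈ Zs, z ∉ w.1 ∧ ∀ g ∈ w.2.1, I.vars g 2 ≠ z ∧ I.vars g 3 ≠ z) (ξ : Fin n → Bool) :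
    fibK I w Zs ξ = 0 := by
  have h1 : ∑ v ∈ w.1 with v ∈ Zs, bit (ξ v) = 0 :=
    sum_eq_zero fun v hv => absurd (mem_filter.1 hv).1 (h v (mem_filter.1 hv).2).1
  have h2 : ∑ g ∈ w.2.1 with (I.vars g 2 ∈ Zs ∧ I.vars g 3 ∈ Zs), bit (ξ (I.vars g 2)) * bit (ξ (I.vars g 3)) = 0 :=
    sum_eq_zero fun g hg => absurd rfl ((h _ (mem_filter.1 hg).2.1).2 g (mem_filter.1 hg).1).1
  unfold fibK
  rw [h1, h2, add_zero]

/-- **A constraint touching no variable of `Zs` has constant fibres.** -/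
theorem fib_const (h : ∀ z ∈ Zs, z ∉ w.1 ∧ ∀ g ∈ w.2.1, I.vars g 2 ≠ z ∧ I.vars g 3 ≠ z) (ξ : Fin n → Bool) :
    fib I w Zs ξ = fib I w Zs (fzero n) := by
  have hL : fibL I w Zs ξ = fibL I w Zs (fzero n) := by
    ext v
    rw [mem_fibL, mem_fibL]
    unfold lcoef
    rw [lin_eq_zero I w Zs (fun z hz => (h z hz).2) ξ, lin_eq_zero I w Zs (fun z hz => (h z hz).2) (fzero n)]
  unfold fib
  rw [hL, fibK_eq_zero I w Zs h ξ, fibK_eq_zero I w Zs h (fzero n)]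

end Fibre

/-! ## Fibring a terminal core -/

/-- **A terminal core fibres into multi-union-terminal data** over any set `Zs` of variables outside `J₀` (`k := n`, only the `Zs`-coordinates of the index matter). -/
theorem multiUnionTerminal_fib (I : LocalMap 4 n m) (hT : Typed I) {r : ℕ} {y : Fin m → Bool} {J₀ : Finset (Fin m)}
    {w₁ w₂ : Finset (Fin n) × Finset (Fin m) × Bool} (ht : Terminal I r y J₀ w₁ w₂) {Zs : Finset (Fin n)} (hZ : ∀ z ∈ Zs, Outside I J₀ z) :
    MultiUnionTerminal I r y J₀ n (fib I w₁ Zs) (fib I w₂ Zs) := by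
  classical
  obtain ⟨hne, hX, hJr, hd₁, hd₂, hr, hT3, hM0⟩ := ht
  have hG₁ : (fib I w₁ Zs (fzero n)).2.1 = fibG I w₁ Zs := rfl
  have hG₂ : (fib I w₂ Zs (fzero n)).2.1 = fibG I w₂ Zs := rfl
  refine ⟨hne, hX, hJr, affineFamily_fib I w₁ Zs, affineFamily_fib I w₂ Zs, ?_, ?_, ?_, ?_, ?_, ?_⟩
  · rw [hG₁]; exact hd₁.mono_right (fibG_subset I w₁ Zs)
  · rw [hG₂]; exact hd₂.mono_right (fibG_subset I w₂ Zs)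
  · rw [hG₁, hG₂]
    exact (card_le_card (union_subset_union (union_subset_union (Subset.refl J₀) (fibG_subset I w₁ Zs)) (fibG_subset I w₂ Zs))).trans hr
  · -- the linear parts move only at AND-slot variables
    intro ξ v hv j hj
    have key : ∀ w : Finset (Fin n) × Finset (Fin m) × Bool, v ∈ (fib I w Zs (fzero n)).1 ∆ (fib I w Zs ξ).1 → I.vars j 0 ≠ v ∧ I.vars j 1 ≠ v := by
      intro w h
      obtain ⟨g, -, hg⟩ := exists_gate_of_mem_symmDiff I w Zs (ξ := ξ) h
      rcases hg with ⟨h2, -⟩ | ⟨h3, -⟩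
      · rw [← h2]; exact ⟨hT j g 0 2 (by decide) (by decide), hT j g 1 2 (by decide) (by decide)⟩
      · rw [← h3]; exact ⟨hT j g 0 3 (by decide) (by decide), hT j g 1 3 (by decide) (by decide)⟩
    rcases mem_union.1 hv with h | h
    · exact key w₁ h
    · exact key w₂ h
  · -- (T3) on every fibre: move the solution onto the fibre
    rintro ξ ⟨x, hxJ, hx1, hx2⟩
    let x' : Fin n → Bool := fun v => if v ∈ Zs then ξ v else x v
    have hx' : ∀ z ∈ Zs, x' z = ξ z := fun z hz => by simp [x', hz]
    have hoff : ∀ v, v ∉ Zs → x v = x' v := fun v hv => by simp [x', hv]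
    refine hT3 ⟨x', fun j hj => ?_, ?_, ?_⟩
    · rw [← hxJ j hj]
      refine eval_congr I j fun s => ?_
      have : I.vars j s ∉ Zs := fun h => hZ _ h j hj (vars_mem_varSet I j s)
      exact (hoff _ this).symm
    · rw [gval_fib_iff I w₁ Zs ξ x' hx', ← gval_fib_congr I w₁ Zs ξ hoff]; exact hx1
    · rw [gval_fib_iff I w₂ Zs ξ x' hx', ← gval_fib_congr I w₂ Zs ξ hoff]; exact hx2
  · -- (M0): the releasing assignment indexes its own fibre
    intro f hf
    obtain ⟨x, hxJ, hx1, hx2⟩ := hM0 f hf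
    exact ⟨x, x, hxJ, (gval_fib_iff I w₁ Zs x x fun _ _ => rfl).1 hx1, (gval_fib_iff I w₂ Zs x x fun _ _ => rfl).1 hx2⟩

end Summit.PneNP.PneNP.Theorems.PstarMultiUnionSplit
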